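import Mathlib
import Summits.AtomisticToContinuum.BoseEinsteinCondensation.Theorems.BECCellInformationTwoScaleReductionLSIBoxStep

/-!
# Route `BECCellInformation` — support item `TwoScaleReduction` (stmt-AtomisticToContinuum-13443):
# the defective logarithmic Sobolev inequality on cubes

Helper file (`--supports stmt-AtomisticToContinuum-13443`), completing `…LSIBoxStep.lean`:

* `lsi_box_eps` — induction on the dimension (base `lsi_box_zero`: the box of `ℝ⁰` is a point),
  for the regularised densities `g² + ε`, `ε > 0`;
* `lsi_box` — the limit `ε → 0⁺` (dominated convergence): for `g ∈ C¹(ℝ^d)`, `B = [a, a+s]^d`,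
  `A = ∫_B g²`:  `∫_B g² log g² ≤ A log(A / s^d) + d A + s² ∫_B |∇g|²`,
  a DEFECTIVE logarithmic Sobolev inequality for Lebesgue measure on a cube with the scaling
  `s²` of the sharp one (Weissler 1980 / Émery–Yukich for the circle, reflection, tensorisation;
  Ledoux, *The concentration of measure phenomenon*, Ch. 5) — the defect `d·A` is harmless in the
  two-scale reduction, where it sums to `d` times the total mass;
* `lsi_euclidean_Icc` — transport to `EuclideanSpace ℝ (Fin m)` (`WithLp.toLp` is volume
  preserving; partial derivatives along `EuclideanSpace.single i 1`);
* `restrict_IcoCell_eq_restrict_IccCell` — half-open and closed cells carry the same restricted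
  Lebesgue measure (null hyperplanes), and
* `lsi_cell` — the form consumed by the chain rule over the cell tiling:
  `∫_Q G² log(s³G²/A) ≤ 3A + s² ∫_Q |∇G|²` for a half-open cube `Q ⊂ ℝ³` of side `s`.
-/

noncomputable section

namespace Summit.AtomisticToContinuum.BoseEinsteinCondensation.Theorems

open MeasureTheory Set
open scoped ENNReal NNReal Topology

namespace TwoScaleReduction

/-! ### The induction: dimension zero and the regularised inequality in every dimension -/

/-- In dimension `0` the box is a point and the regularised inequality is an equality.
[folklore] -/
theorem lsi_box_zero {s ε : ℝ} (g : (Fin 0 → ℝ) → ℝ) (a : Fin 0 → ℝ) :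
    ∫ x in Icc a (fun j => a j + s), (g x ^ 2 + ε) * Real.log (g x ^ 2 + ε) ≤
      (∫ x in Icc a (fun j => a j + s), (g x ^ 2 + ε)) *
          Real.log ((∫ x in Icc a (fun j => a j + s), (g x ^ 2 + ε)) / s ^ 0) +
        ((0 : ℕ) : ℝ) * (∫ x in Icc a (fun j => a j + s), (g x ^ 2 + ε)) +
        s ^ 2 * ∫ x in Icc a (fun j => a j + s), ∑ i, (fderiv ℝ g x (Pi.single i 1)) ^ 2 := by
  have hS : Icc a (fun j => a j + s) = univ := by
    ext x; simp
  have hvol : (volume : Measure (Fin 0 → ℝ)) = Measure.dirac a := Measure.volume_pi_eq_dirac a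
  simp [hS, hvol]

/-- **The regularised defective LSI on boxes, every dimension**: for `ε > 0`, `s > 0`, `g ∈ C¹`,
`B = [a, a+s]^d`, `f = g² + ε`, `A = ∫_B f`:
`∫_B f log f ≤ A log(A / s^d) + d A + s² ∫_B |∇g|²`. [folklore] -/
theorem lsi_box_eps (d : ℕ) {s ε : ℝ} (hs : 0 < s) (hε : 0 < ε) :
    ∀ (g : (Fin d → ℝ) → ℝ), ContDiff ℝ 1 g → ∀ a : Fin d → ℝ,
      ∫ x in Icc a (fun j => a j + s), (g x ^ 2 + ε) * Real.log (g x ^ 2 + ε) ≤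
        (∫ x in Icc a (fun j => a j + s), (g x ^ 2 + ε)) *
            Real.log ((∫ x in Icc a (fun j => a j + s), (g x ^ 2 + ε)) / s ^ d) +
          (d : ℝ) * (∫ x in Icc a (fun j => a j + s), (g x ^ 2 + ε)) +
          s ^ 2 * ∫ x in Icc a (fun j => a j + s), ∑ i, (fderiv ℝ g x (Pi.single i 1)) ^ 2 := by
  induction d with
  | zero => intro g _ a; exact_mod_cast lsi_box_zero g a
  | succ d ih => intro g hg a; exact lsi_box_succ hs hε ih g hg a

/-! ### The limit `ε → 0` -/

/-- `|y log y| ≤ y² + 1` for `y ≥ 0`. [folklore] -/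
theorem abs_mul_log_le {y : ℝ} (hy : 0 ≤ y) : |y * Real.log y| ≤ y ^ 2 + 1 := by
  rcases le_or_gt y 1 with h | h
  · rcases hy.eq_or_lt with h0 | h0
    · rw [← h0]; simp
    · have := Real.abs_log_mul_self_lt y h0 h
      rw [mul_comm] at this
      nlinarith [abs_nonneg (y * Real.log y), sq_nonneg y]
  · have hlog : 0 ≤ Real.log y := Real.log_nonneg h.le
    have hle : Real.log y ≤ y - 1 := Real.log_le_sub_one_of_pos (by linarith)
    rw [abs_of_nonneg (mul_nonneg hy hlog)]
    nlinarith [mul_le_mul_of_nonneg_left hle hy]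

/-- **The defective LSI on boxes**: for `s > 0`, `g ∈ C¹(ℝ^d)`, `B = [a, a+s]^d`, `A = ∫_B g²`:
`∫_B g² log g² ≤ A log(A / s^d) + d A + s² ∫_B |∇g|²` (limit `ε → 0` of `lsi_box_eps` by
dominated convergence). [folklore] -/
theorem lsi_box (d : ℕ) {s : ℝ} (hs : 0 < s) (g : (Fin d → ℝ) → ℝ) (hg : ContDiff ℝ 1 g)
    (a : Fin d → ℝ) :
    ∫ x in Icc a (fun j => a j + s), g x ^ 2 * Real.log (g x ^ 2) ≤
      (∫ x in Icc a (fun j => a j + s), g x ^ 2) *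
          Real.log ((∫ x in Icc a (fun j => a j + s), g x ^ 2) / s ^ d) +
        (d : ℝ) * (∫ x in Icc a (fun j => a j + s), g x ^ 2) +
        s ^ 2 * ∫ x in Icc a (fun j => a j + s), ∑ i, (fderiv ℝ g x (Pi.single i 1)) ^ 2 := by
  set B := Icc a (fun j => a j + s) with hB
  set J := ∫ x in B, ∑ i, (fderiv ℝ g x (Pi.single i 1)) ^ 2 with hJ
  set A := ∫ x in B, g x ^ 2 with hA
  have hgc : Continuous g := hg.continuous
  have hint : ∀ {φ : (Fin d → ℝ) → ℝ}, Continuous φ → Integrable φ (volume.restrict B) :=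
    fun hφ => integrableOn_box hφ a s
  -- the left-hand side converges (dominated convergence)
  have hL : Filter.Tendsto (fun ε : ℝ => ∫ x in B, (g x ^ 2 + ε) * Real.log (g x ^ 2 + ε))
      (𝓝[>] 0) (𝓝 (∫ x in B, g x ^ 2 * Real.log (g x ^ 2))) := by
    refine tendsto_integral_filter_of_dominated_convergence (fun x => (g x ^ 2 + 1) ^ 2 + 1)
      ?_ ?_ ?_ ?_
    · refine Filter.Eventually.of_forall fun ε => Continuous.aestronglyMeasurable ?_
      exact Real.continuous_mul_log.comp (by fun_prop)
    · filter_upwards [Ioo_mem_nhdsGT (zero_lt_one' ℝ)] with ε hε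
      refine Filter.Eventually.of_forall fun x => ?_
      have hy : 0 ≤ g x ^ 2 + ε := by nlinarith [sq_nonneg (g x), hε.1]
      have h1 := abs_mul_log_le hy
      have h2 : (g x ^ 2 + ε) ^ 2 ≤ (g x ^ 2 + 1) ^ 2 := by
        apply pow_le_pow_left₀ hy; linarith [hε.2]
      rw [Real.norm_eq_abs]
      linarith
    · exact hint (by fun_prop)
    · refine Filter.Eventually.of_forall fun x => ?_
      have hc : Filter.Tendsto (fun ε : ℝ => g x ^ 2 + ε) (𝓝[>] 0) (𝓝 (g x ^ 2)) := by
        have : Filter.Tendsto (fun ε : ℝ => g x ^ 2 + ε) (𝓝 0) (𝓝 (g x ^ 2 + 0)) :=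
          tendsto_const_nhds.add Filter.tendsto_id
        rw [add_zero] at this
        exact this.mono_left nhdsWithin_le_nhds
      exact (Real.continuous_mul_log.tendsto _).comp hc
  -- the right-hand side converges (continuity)
  have hAε : ∀ ε : ℝ, ∫ x in B, (g x ^ 2 + ε) = A + ε * s ^ d := by
    intro ε
    rw [integral_add (hint (by fun_prop)) (hint continuous_const), setIntegral_const,
      volume_real_box a hs.le, smul_eq_mul, mul_comm]
  have hR : Filter.Tendsto (fun ε : ℝ => (∫ x in B, (g x ^ 2 + ε)) *
        Real.log ((∫ x in B, (g x ^ 2 + ε)) / s ^ d) + (d : ℝ) * (∫ x in B, (g x ^ 2 + ε)) +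
        s ^ 2 * J) (𝓝[>] 0) (𝓝 (A * Real.log (A / s ^ d) + d * A + s ^ 2 * J)) := by
    simp_rw [hAε]
    have h1 : Continuous fun x : ℝ => x * Real.log (x / s ^ d) := by
      have e : (fun x : ℝ => x * Real.log (x / s ^ d)) =
          fun x => s ^ d * ((x / s ^ d) * Real.log (x / s ^ d)) := by
        funext x; field_simp
      rw [e]
      exact continuous_const.mul (Real.continuous_mul_log.comp (continuous_id.div_const _))
    have hΦ : Continuous fun ε : ℝ => (A + ε * s ^ d) * Real.log ((A + ε * s ^ d) / s ^ d) +
        (d : ℝ) * (A + ε * s ^ d) + s ^ 2 * J :=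
      ((h1.comp (continuous_const.add (continuous_id.mul continuous_const))).add
        (continuous_const.mul (continuous_const.add (continuous_id.mul continuous_const)))).add
        continuous_const
    have := hΦ.tendsto 0
    simp only [zero_mul, add_zero] at this
    exact this.mono_left nhdsWithin_le_nhds
  -- the regularised inequality, eventually along `ε → 0⁺`
  have hE : ∀ᶠ ε in 𝓝[>] (0 : ℝ), ∫ x in B, (g x ^ 2 + ε) * Real.log (g x ^ 2 + ε) ≤
      (∫ x in B, (g x ^ 2 + ε)) * Real.log ((∫ x in B, (g x ^ 2 + ε)) / s ^ d) +
        (d : ℝ) * (∫ x in B, (g x ^ 2 + ε)) + s ^ 2 * J :=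
    eventually_mem_nhdsWithin.mono fun ε hε => lsi_box_eps d hs hε g hg a
  exact le_of_tendsto_of_tendsto hL hR hE

/-! ### Transport to `EuclideanSpace ℝ (Fin m)` -/

/-- The pullback of `G : EuclideanSpace ℝ (Fin m) → ℝ` to `Fin m → ℝ` has the same partial
derivatives: `D(G ∘ toLp)(y)[eᵢ] = DG(toLp y)[eᵢ]`. [folklore] -/
theorem fderiv_comp_toLp_apply_single {m : ℕ} (G : EuclideanSpace ℝ (Fin m) → ℝ)
    (y : Fin m → ℝ) (i : Fin m) :
    fderiv ℝ (fun y' : Fin m → ℝ => G (WithLp.toLp 2 y')) y (Pi.single i 1) =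
      fderiv ℝ G (WithLp.toLp 2 y) (EuclideanSpace.single i 1) := by
  have h := ContinuousLinearEquiv.comp_right_fderiv (𝕜 := ℝ) (f := G)
    (iso := (PiLp.continuousLinearEquiv 2 ℝ (fun _ : Fin m => ℝ)).symm) (x := y)
  simp only [PiLp.coe_symm_continuousLinearEquiv] at h
  rw [show (fun y' : Fin m → ℝ => G (WithLp.toLp 2 y')) = G ∘ WithLp.toLp 2 from rfl, h]
  rfl

/-- **The defective LSI on a closed cube of `ℝ^m`** (Euclidean space): for `s > 0`,
`G ∈ C¹`, `Q = {x | ∀ j, x j ∈ [a j, a j + s]}`, `A = ∫_Q G²`: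
`∫_Q G² log G² ≤ A log(A / s^m) + m A + s² ∫_Q |∇G|²`. [folklore] -/
theorem lsi_euclidean_Icc {m : ℕ} {s : ℝ} (hs : 0 < s) (G : EuclideanSpace ℝ (Fin m) → ℝ)
    (hG : ContDiff ℝ 1 G) (a : Fin m → ℝ) :
    ∫ x in {y : EuclideanSpace ℝ (Fin m) | ∀ j, y j ∈ Icc (a j) (a j + s)},
        G x ^ 2 * Real.log (G x ^ 2) ≤
      (∫ x in {y : EuclideanSpace ℝ (Fin m) | ∀ j, y j ∈ Icc (a j) (a j + s)}, G x ^ 2) *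
          Real.log ((∫ x in {y : EuclideanSpace ℝ (Fin m) | ∀ j, y j ∈ Icc (a j) (a j + s)},
            G x ^ 2) / s ^ m) +
        (m : ℝ) * (∫ x in {y : EuclideanSpace ℝ (Fin m) | ∀ j, y j ∈ Icc (a j) (a j + s)},
          G x ^ 2) +
        s ^ 2 * ∫ x in {y : EuclideanSpace ℝ (Fin m) | ∀ j, y j ∈ Icc (a j) (a j + s)},
          ∑ i, (fderiv ℝ G x (EuclideanSpace.single i 1)) ^ 2 := by
  set S := {y : EuclideanSpace ℝ (Fin m) | ∀ j, y j ∈ Icc (a j) (a j + s)} with hSdef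
  set e := MeasurableEquiv.toLp 2 (Fin m → ℝ) with he_def
  have hmp : MeasurePreserving e volume volume := by
    rw [he_def]
    have := PiLp.volume_preserving_toLp (Fin m)
    rwa [← MeasurableEquiv.coe_toLp] at this
  have he : ∀ y, e y = WithLp.toLp 2 y := fun y => by simp [he_def]
  have hpre : e ⁻¹' S = Icc a (fun j => a j + s) := by
    ext y
    simp only [hSdef, Set.mem_preimage, Set.mem_setOf_eq, he, Set.mem_Icc, Pi.le_def]
    exact ⟨fun h => ⟨fun j => (h j).1, fun j => (h j).2⟩, fun h j => ⟨h.1 j, h.2 j⟩⟩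
  have htr : ∀ Φ : EuclideanSpace ℝ (Fin m) → ℝ,
      ∫ x in S, Φ x = ∫ y in Icc a (fun j => a j + s), Φ (WithLp.toLp 2 y) := by
    intro Φ
    rw [← hmp.setIntegral_preimage_emb e.measurableEmbedding Φ S, hpre]
    simp only [he]
  set g : (Fin m → ℝ) → ℝ := fun y => G (WithLp.toLp 2 y) with hgdef
  have hg : ContDiff ℝ 1 g := by
    have h := hG.comp (PiLp.continuousLinearEquiv 2 ℝ (fun _ : Fin m => ℝ)).symm.contDiff
    simp only [PiLp.coe_symm_continuousLinearEquiv] at h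
    exact h
  have key := lsi_box m hs g hg a
  have hgrad : ∀ y : Fin m → ℝ, (∑ i, (fderiv ℝ g y (Pi.single i 1)) ^ 2) =
      ∑ i, (fderiv ℝ G (WithLp.toLp 2 y) (EuclideanSpace.single i 1)) ^ 2 := fun y => by
    simp only [hgdef, fderiv_comp_toLp_apply_single]
  simp_rw [hgrad] at key
  rw [htr, htr, htr fun x => ∑ i, (fderiv ℝ G x (EuclideanSpace.single i 1)) ^ 2]
  exact key

/-! ### Half-open cells of `ℝ^m`: `Ico` versus `Icc` -/

/-- Coordinate hyperplanes are Lebesgue-null in `EuclideanSpace ℝ (Fin m)`. [folklore] -/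
theorem volume_hyperplane_eq_zero {m : ℕ} (j : Fin m) (c : ℝ) :
    volume {y : EuclideanSpace ℝ (Fin m) | y j = c} = 0 := by
  have hmp := PiLp.volume_preserving_ofLp (Fin m)
  have hset : {y : EuclideanSpace ℝ (Fin m) | y j = c} =
      (WithLp.ofLp : EuclideanSpace ℝ (Fin m) → Fin m → ℝ) ⁻¹' {f : Fin m → ℝ | f j = c} :=
    Set.ext fun _ => Iff.rfl
  have hmeas : MeasurableSet {f : Fin m → ℝ | f j = c} :=
    measurableSet_eq_fun (measurable_pi_apply j) measurable_const
  rw [hset, hmp.measure_preimage hmeas.nullMeasurableSet, volume_pi]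
  exact Measure.pi_hyperplane (μ := fun _ : Fin m => (volume : Measure ℝ)) j c

/-- The closed coordinate cell is compact. [folklore] -/
theorem isCompact_IccCell {m : ℕ} (a b : Fin m → ℝ) :
    IsCompact {y : EuclideanSpace ℝ (Fin m) | ∀ j, y j ∈ Icc (a j) (b j)} := by
  have hset : {y : EuclideanSpace ℝ (Fin m) | ∀ j, y j ∈ Icc (a j) (b j)} =
      (PiLp.continuousLinearEquiv 2 ℝ (fun _ : Fin m => ℝ)).toHomeomorph ⁻¹' Icc a b := by
    ext y
    simp only [Set.mem_setOf_eq, Set.mem_preimage, Set.mem_Icc, Pi.le_def,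
      ContinuousLinearEquiv.coe_toHomeomorph, PiLp.coe_continuousLinearEquiv]
    exact ⟨fun h => ⟨fun j => (h j).1, fun j => (h j).2⟩, fun h j => ⟨h.1 j, h.2 j⟩⟩
  rw [hset]
  exact (Homeomorph.isCompact_preimage _).2 isCompact_Icc

/-- **The half-open and the closed cell carry the same restricted Lebesgue measure** (they
differ by finitely many null hyperplanes). [folklore] -/
theorem restrict_IcoCell_eq_restrict_IccCell {m : ℕ} (a b : Fin m → ℝ) :
    (volume : Measure (EuclideanSpace ℝ (Fin m))).restrict
        {y : EuclideanSpace ℝ (Fin m) | ∀ j, y j ∈ Ico (a j) (b j)} =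
      volume.restrict {y : EuclideanSpace ℝ (Fin m) | ∀ j, y j ∈ Icc (a j) (b j)} := by
  refine Measure.restrict_congr_set ?_
  have hsub : {y : EuclideanSpace ℝ (Fin m) | ∀ j, y j ∈ Ico (a j) (b j)} ⊆
      {y | ∀ j, y j ∈ Icc (a j) (b j)} := fun y hy j => Ico_subset_Icc_self (hy j)
  refine hsub.eventuallyLE.antisymm ?_
  have hnull : volume (⋃ j : Fin m, {y : EuclideanSpace ℝ (Fin m) | y j = b j}) = 0 :=
    measure_iUnion_null fun j => volume_hyperplane_eq_zero j (b j)
  filter_upwards [measure_eq_zero_iff_ae_notMem.1 hnull] with y hy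
  intro (h : ∀ j, y j ∈ Icc (a j) (b j)) j
  exact ⟨(h j).1, lt_of_le_of_ne (h j).2 fun h' => hy (Set.mem_iUnion.2 ⟨j, h'⟩)⟩

/-! ### The cell inequality in chain-rule form -/

/-- **Defective LSI on a half-open cube of `ℝ³`, chain-rule form.** For `s > 0`, `G ∈ C¹(ℝ³)`,
`Q = {x | ∀ j, x j ∈ [a j, a j + s)}` and `A = ∫_Q G²`:

  `∫_Q G² log(s³ G² / A) ≤ 3 A + s² ∫_Q |∇G|²`,

i.e. `A · KL(p_Q ‖ u_Q) ≤ 3A + s² ∫_Q |∇G|²` for the cell law `p_Q = G²/A` against the uniform law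
`u_Q` (for `A = 0` both sides are read with Lean's `x / 0 = 0`, `log 0 = 0` and the left side
vanishes). This is the within-cell input of the two-scale reduction. [folklore] -/
theorem lsi_cell {s : ℝ} (hs : 0 < s) (G : EuclideanSpace ℝ (Fin 3) → ℝ) (hG : ContDiff ℝ 1 G)
    (a : Fin 3 → ℝ) :
    ∫ x in {y : EuclideanSpace ℝ (Fin 3) | ∀ j, y j ∈ Ico (a j) (a j + s)},
        G x ^ 2 * Real.log (s ^ 3 * G x ^ 2 /
          ∫ z in {y : EuclideanSpace ℝ (Fin 3) | ∀ j, y j ∈ Ico (a j) (a j + s)}, G z ^ 2) ≤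
      3 * (∫ x in {y : EuclideanSpace ℝ (Fin 3) | ∀ j, y j ∈ Ico (a j) (a j + s)}, G x ^ 2) +
        s ^ 2 * ∫ x in {y : EuclideanSpace ℝ (Fin 3) | ∀ j, y j ∈ Ico (a j) (a j + s)},
          ∑ i, (fderiv ℝ G x (EuclideanSpace.single i 1)) ^ 2 := by
  have hres := restrict_IcoCell_eq_restrict_IccCell a (fun j => a j + s)
  simp only at hres
  rw [hres]
  have key := lsi_euclidean_Icc hs G hG a
  set S := {y : EuclideanSpace ℝ (Fin 3) | ∀ j, y j ∈ Icc (a j) (a j + s)} with hSdef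
  set A := ∫ x in S, G x ^ 2 with hAdef
  set J := ∫ x in S, ∑ i, (fderiv ℝ G x (EuclideanSpace.single i 1)) ^ 2 with hJdef
  have hJ : 0 ≤ J := integral_nonneg fun x => Finset.sum_nonneg fun i _ => sq_nonneg _
  have hA : 0 ≤ A := integral_nonneg fun x => sq_nonneg _
  rcases hA.eq_or_lt with hA0 | hApos
  · rw [← hA0]
    simp only [div_zero, Real.log_zero, mul_zero, integral_zero]
    nlinarith [hJ, sq_nonneg s]
  have hpt : ∀ x, G x ^ 2 * Real.log (s ^ 3 * G x ^ 2 / A) =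
      G x ^ 2 * Real.log (G x ^ 2) + G x ^ 2 * Real.log (s ^ 3 / A) := by
    intro x
    rcases (sq_nonneg (G x)).eq_or_lt with h0 | hpos
    · rw [← h0]; simp
    · rw [show s ^ 3 * G x ^ 2 / A = G x ^ 2 * (s ^ 3 / A) by ring,
        Real.log_mul hpos.ne' (by positivity)]
      ring
  simp_rw [hpt]
  have hGc : Continuous G := hG.continuous
  have iS : ∀ {φ : EuclideanSpace ℝ (Fin 3) → ℝ}, Continuous φ → Integrable φ (volume.restrict S) :=
    fun hφ => hφ.continuousOn.integrableOn_compact (isCompact_IccCell a _)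
  have i1 : Integrable (fun x => G x ^ 2 * Real.log (G x ^ 2)) (volume.restrict S) :=
    iS (Real.continuous_mul_log.comp (hGc.pow 2))
  have i2 : Integrable (fun x => G x ^ 2 * Real.log (s ^ 3 / A)) (volume.restrict S) :=
    iS ((hGc.pow 2).mul continuous_const)
  rw [integral_add i1 i2, integral_mul_const]
  have hlog : Real.log (s ^ 3 / A) = -Real.log (A / s ^ 3) := by
    rw [← Real.log_inv, inv_div]
  rw [hlog]
  push_cast at key
  linarith

end TwoScaleReduction

end Summit.AtomisticToContinuum.BoseEinsteinCondensation.Theorems
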